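import Literature.MathematicalPhysics.PowerSystems.CompleteNetworkUniqueStableState
import HarnessLib

/-!
# Sufficiently dense Kuramoto networks have no stable pattern: Kassabov–Strogatz–Townsend's
# Theorem 5 (`μ̄ > 3/4` ⇒ the only stable equilibrium is the all-in-phase state), with the
# Ling–Xu–Bandeira bound on the way — print's notion, Lyapunov's notion, and the swing twin

Topic `Literature/MathematicalPhysics/PowerSystems`, namespaces
`Literature.MathematicalPhysics.PowerSystems.{NonuniformKuramoto, ClassicalModel.LosslessSystem}`.
Third panel of the «topology vs multistability» story of this topic: single loops carry
`2⌈N/4⌉ − 1` stable phase-locked states (`ring_lockedSolution_stable_iff_twisted`), the complete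
network carries one (`complete_lockedSolution_stable_iff_inPhase`, Taylor's Thm 4.1), and — this
file — EVERY network in which each oscillator is coupled to more than three quarters of the others
carries one: the all-in-phase state. We follow the printed proof of M. Kassabov, S. H. Strogatz,
A. Townsend (2021) step by step, in UNNORMALISED variables (`a + ib = Σⱼ e^{iθⱼ} = nρ₁`,
`a₂ + ib₂ = Σⱼ e^{2iθⱼ} = nρ₂`, `d = n(1 − μ̄)` = a bound on the non-neighbour mass
`Σ_{k≠j}(1 − Pⱼₖ)` of every node), in the centred frame `b = 0, a ≥ 0` («we may assume that ρ₁ is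
real-valued and non-negative»), for weights `0 ≤ Pⱼₖ ≤ 1` (print: `Aⱼₖ ∈ {0,1}`) and with «stable»
meaning, as the print's linear analysis uses it, that the stability matrix `M(θ) = −L(θ)` of
`KuramotoCutsetStabilityNecessity` is negative semidefinite; the Lyapunov notion and the damped
second-order (swing) model follow by the bridges of that file. Everything is PROVED; no definition,
no named fact, no axiom.

SOURCE (read on the page this session). M. Kassabov, S. H. Strogatz, A. Townsend, *Sufficiently
dense Kuramoto networks are globally synchronizing*, Chaos 31 (2021) 073135
[KassabovStrogatzTownsend2021] (`lit read arxiv:2105.11406`, held LaTeX): §1 model (1.1)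
`θ̇ⱼ = Σₖ Aⱼₖ sin(θₖ − θⱼ)` (identical frequencies, rotating frame), connectivity `μ`, critical
connectivity; §2 self-loops, `μ̄ = (μ(n−1)+1)/n` (2.1), the degree form (2.2)
`μ > ⌊3n/4 − 1⌋/(n−1)`; §3 moments `ρₘ`, normalisation `ψ = 0`, identity (3.1), Ling–Xu–Bandeira's
inequality «when θ is a stable equilibrium, −Σ A cos + Σ A cos² ≤ 0» (p. 1893 of LXB, quoted), the
lower bound (3.2)–(3.3); §4 **Lemma 1** (4.1) with proof (4.2), (4.3) `ρ₁|sin θⱼ| ≤ 1 − μ̄`,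
**Corollary 2** (`ρ₁ > √2(1 − μ̄)` ⇒ all-in-phase, via LXB Prop. 5); §5 (5.1), (5.2)
`ρ₁² ≥ 2(μ̄ − 3/4) + ½|ρ₂|²` («also implies the one found by Ling, Xu, and Bandeira … μ_c ≤
0.7929»), **Lemma 3** (5.3)–(5.6) (tangent-line bound), **Lemma 4** (`μ̄ > 3/4` ⇒ `|ρ₂| ≥ ½`,
optimal `x₀*`), **Theorem 5** «If μ̄ > 3/4, then the only stable equilibrium is the all-in-phase
state» (arXiv p0003–p0008). R. Taylor, J. Phys. A 45 (2012) 055102 [TaylorKuramoto2012] §2 Lemma 2.1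
and §4.2 proof of Thm 4.2, Case 1 (the half-circle / connectivity step) (arXiv:1109.4451 p0008,
p0012). D. Manik, M. Timme, D. Witthaut, Chaos 27 (2017) 083123 [ManikTimmeWitthaut2017] §3 Lemma 1 /
Cor. 1; H. K. Khalil [Khalil2002] Thm 4.7 — through the typed bridges.

## What is proved (`Kur : NonuniformKuramoto n`; `wⱼₖ = Pⱼₖcos(θⱼ − θₖ)`; sums over all nodes)

* §1 `sum_sum_weight_cos_mul_one_sub_cos_nonneg` — LXB's inequality from `M` NSD (test vectors
  `cos θ`, `sin θ`; no symmetry needed).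
* §2 `sum_sum_cos_sub_eq` (`ΣΣcos(θⱼ − θₖ) = a² + b²`), `sum_sum_cos_sub_sq_eq`
  (`ΣΣcos² = (n² + a₂² + b₂²)/2`, identity (3.1)).
* §3 `sum_sin_sub_eq_of_centred`, `sum_nonneighbour_sin_eq`, `weighted_cauchy_schwarz`, ★
  **`sq_sum_nonneighbour_abs_cos_le`** (LEMMA 1: `(Σ_{k≠j}(1 − Pⱼₖ)|cos(θₖ − θⱼ)|)² ≤ d² − a²sin²θⱼ`),
  `mul_abs_sin_le` ((4.3): `a|sin θⱼ| ≤ d`).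
* §4 `inPhase_of_cos_pos` (an equilibrium in an open half-plane on a connected network is in
  phase), ★ **`inPhase_of_sq_gt`** (COROLLARY 2: `a² > 2d²` ⇒ in phase — via Taylor's cut lemma on
  the split by the sign of `cos θⱼ`).
* §5 ★ `sq_sum_cos_ge_aux` ((5.1)), ★ `sq_sum_cos_ge` ((5.2): `a² ≥ n²/2 − 2nd + (a₂² + b₂²)/2`), ★★
  **`inPhase_of_dense_LXB`** (the Ling–Xu–Bandeira bound: `4d² + 4nd < n²`, i.e. `μ̄ > 0.7929`, ⇒ in
  phase).
* §6 ★★★ **`inPhase_of_dense_centred`** (THEOREM 5 in the centred frame: `4d < n` ⇒ in phase;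
  Lemma 3 as AM–GM at the optimal tangent point `y₀ = (n² − 2a²)²/(16n²)`, Lemma 4, (5.2)).
* §7 `lap_sub_const`, `couplingConnected_of_dense` (density ⇒ connectivity), ★★★
  **`inPhase_of_dense`** (Theorem 5 in any frame, rotation by `arg Σe^{iθⱼ}`),
  `sum_weight_sin_eq_zero_of_locked`, ★★★ **`dense_cos_eq_one_of_stabilityMatrix_negSemidef`**
  (THEOREM 5 FOR THE MODEL, print's notion: first-order Kuramoto network with symmetric weights in
  `[0,1]`, identical specific natural frequencies `ωⱼ = Dⱼc`, any `Dⱼ > 0`, every node with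
  `4·Σ_{k≠j}(1 − Pⱼₖ) < n`; a phase-locked state with NSD stability matrix is all-in-phase), ★★★
  **`dense_lockedSolution_stable_iff_inPhase`** (LYAPUNOV DICHOTOMY: the locked solution is Lyapunov
  stable ⇔ in phase).
* §8 SWING TWIN (`S : ClassicalModel.LosslessSystem n 0`, symmetric `0 ≤ Cⱼₖ ≤ 1`, `P = 0`,
  `Mᵢ, Dᵢ > 0`, `4·Σ_{k≠j}(1 − Cⱼₖ) < n`): ★★ **`dense_cos_eq_one_of_stable`**, ★★★
  **`dense_stable_iff_inPhase`**.

THREE COLUMNS. CERTIFIED for MODEL `M_K` = first-order Kuramoto network with symmetric weights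
`Pⱼₖ ∈ [0,1]`, identical specific natural frequencies, any `Dⱼ > 0`, and MODEL `M_S` = damped lossless
swing model with the same couplings and zero injections, under the density hypothesis «every node
has non-neighbour mass `< n/4`»: the all-in-phase state is the ONLY Lyapunov-stable (resp.
linearly stable) phase-locked / synchronous state. NOT CLAIMED: the print's almost-global convergence
(«globally synchronizing» — gradient-flow genericity, not typed), the sharpness discussion
(`μ_c ≥ 0.6838`, razor's-edge networks), non-identical frequencies or weights outside `[0,1]`;
anything about a grid (MODELLED: an unloaded idealised oscillator network; a Kron-reduced grid is
dense but loaded and non-uniformly coupled — gap stated, not bridged).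
-/

noncomputable section

open Real Set Filter Topology Metric Finset
open scoped Matrix

namespace Literature.MathematicalPhysics.PowerSystems

namespace NonuniformKuramoto

variable {n : ℕ} (Kur : NonuniformKuramoto n)

/-! ### §1. Ling–Xu–Bandeira's second-order inequality -/

/-- **LXB's inequality**: if the stability matrix `M(θ) = −L(θ)` is negative semidefinite then
`Σⱼ Σₖ Pⱼₖ cos(θⱼ − θₖ)(1 − cos(θⱼ − θₖ)) ≥ 0` (test the quadratic form with `z = (cos θⱼ)ⱼ` and
`z = (sin θⱼ)ⱼ` and add: `cos θⱼ(cos θⱼ − cos θₖ) + sin θⱼ(sin θⱼ − sin θₖ) = 1 − cos(θⱼ − θₖ)`).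
«when θ is a stable equilibrium, then −Σ A cos(θₖ − θⱼ) + Σ A cos²(θₖ − θⱼ) ≤ 0.»
[cite: KassabovStrogatzTownsend2021, §3.1 display before (3.2) (arXiv:2105.11406 p0005: «Ling, Xu, and Bandeira proved (see p. 1893 of their paper) that when θ is a stable equilibrium, then …»)] -/
theorem sum_sum_weight_cos_mul_one_sub_cos_nonneg {θ : Fin n → ℝ}
    (hst : ∀ z : Fin n → ℝ, z ⬝ᵥ ((-Kur.toDroopNetwork.lap θ) *ᵥ z) ≤ 0) :
    0 ≤ ∑ j, ∑ k, Kur.P j k * Real.cos (θ j - θ k) * (1 - Real.cos (θ j - θ k)) := by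
  have hform : ∀ z : Fin n → ℝ,
      0 ≤ ∑ j, ∑ k, Kur.P j k * Real.cos (θ j - θ k) * (z j * (z j - z k)) := by
    intro z
    have h := hst z
    rw [Matrix.neg_mulVec, dotProduct_neg, neg_nonpos, Kur.dotProduct_lap_mulVec] at h
    have e : ∑ j, z j * ∑ k, Kur.toDroopNetwork.linWeight θ j k * (z j - z k)
        = ∑ j, ∑ k, Kur.P j k * Real.cos (θ j - θ k) * (z j * (z j - z k)) := by
      refine Finset.sum_congr rfl fun j _ => ?_
      rw [Finset.mul_sum]
      refine Finset.sum_congr rfl fun k _ => ?_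
      rw [Kur.toDroopNetwork_linWeight]
      ring
    rw [e] at h
    exact h
  have h1 := hform fun j => Real.cos (θ j)
  have h2 := hform fun j => Real.sin (θ j)
  have e : ∑ j, ∑ k, Kur.P j k * Real.cos (θ j - θ k) * (1 - Real.cos (θ j - θ k))
      = ∑ j, ∑ k, Kur.P j k * Real.cos (θ j - θ k)
          * (Real.cos (θ j) * (Real.cos (θ j) - Real.cos (θ k)))
        + ∑ j, ∑ k, Kur.P j k * Real.cos (θ j - θ k)
          * (Real.sin (θ j) * (Real.sin (θ j) - Real.sin (θ k))) := by
    rw [← Finset.sum_add_distrib]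
    refine Finset.sum_congr rfl fun j _ => ?_
    rw [← Finset.sum_add_distrib]
    refine Finset.sum_congr rfl fun k _ => ?_
    have hc : Real.cos (θ j - θ k) = Real.cos (θ j) * Real.cos (θ k) + Real.sin (θ j) * Real.sin (θ k) :=
      Real.cos_sub _ _
    have h1' : Real.sin (θ j) ^ 2 + Real.cos (θ j) ^ 2 = 1 := Real.sin_sq_add_cos_sq _
    rw [hc]
    linear_combination (-(Kur.P j k * (Real.cos (θ j) * Real.cos (θ k)
      + Real.sin (θ j) * Real.sin (θ k)))) * h1'
  rw [e]
  exact add_nonneg h1 h2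

/-! ### §2. The first two moments: `ΣΣ cos(θⱼ − θₖ) = a² + b²`, `ΣΣ cos² = (n² + a₂² + b₂²)/2` -/

/-- `Σⱼ Σₖ cos(θⱼ − θₖ) = (Σⱼ cos θⱼ)² + (Σⱼ sin θⱼ)²` (`= n²|ρ₁|²`).
[cite: KassabovStrogatzTownsend2021, §3.1 first display (arXiv:2105.11406 p0005)] -/
theorem sum_sum_cos_sub_eq (θ : Fin n → ℝ) :
    ∑ j, ∑ k, Real.cos (θ j - θ k) = (∑ j, Real.cos (θ j)) ^ 2 + (∑ j, Real.sin (θ j)) ^ 2 := by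
  rw [sq, sq, Finset.sum_mul_sum, Finset.sum_mul_sum, ← Finset.sum_add_distrib]
  refine Finset.sum_congr rfl fun j _ => ?_
  rw [← Finset.sum_add_distrib]
  exact Finset.sum_congr rfl fun k _ => Real.cos_sub _ _

/-- `Σⱼ Σₖ cos²(θⱼ − θₖ) = (n² + (Σⱼ cos 2θⱼ)² + (Σⱼ sin 2θⱼ)²)/2` (`= n²(1 + |ρ₂|²)/2`).
[cite: KassabovStrogatzTownsend2021, §3.1 eq. (3.1) (arXiv:2105.11406 p0005)] -/
theorem sum_sum_cos_sub_sq_eq (θ : Fin n → ℝ) :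
    ∑ j, ∑ k, Real.cos (θ j - θ k) ^ 2
      = ((n : ℝ) ^ 2 + (∑ j, Real.cos (2 * θ j)) ^ 2 + (∑ j, Real.sin (2 * θ j)) ^ 2) / 2 := by
  have h2 := sum_sum_cos_sub_eq (fun j => 2 * θ j)
  have e : ∑ j, ∑ k, Real.cos (θ j - θ k) ^ 2 = ∑ j, ∑ k, (1 / 2 + Real.cos (2 * θ j - 2 * θ k) / 2) := by
    refine Finset.sum_congr rfl fun j _ => Finset.sum_congr rfl fun k _ => ?_
    rw [Real.cos_sq, mul_sub]
  rw [e]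
  have e2 : ∑ j, ∑ k, (1 / 2 + Real.cos (2 * θ j - 2 * θ k) / 2)
      = ∑ _j : Fin n, ∑ _k : Fin n, (1 / 2 : ℝ) + (∑ j, ∑ k, Real.cos (2 * θ j - 2 * θ k)) / 2 := by
    rw [Finset.sum_div, ← Finset.sum_add_distrib]
    refine Finset.sum_congr rfl fun j _ => ?_
    rw [Finset.sum_div, ← Finset.sum_add_distrib]
  rw [e2, h2]
  simp only [Finset.sum_const, Finset.card_univ, Fintype.card_fin, nsmul_eq_mul]
  ring

/-! ### §3. KST's Lemma 1: a per-node Cauchy–Schwarz bound on the non-neighbours -/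

/-- In the centred frame (`Σⱼ sin θⱼ = 0`, `a = Σⱼ cos θⱼ`) the sine sum at node `j` is
`Σₖ sin(θₖ − θⱼ) = −a sin θⱼ`. [cite: KassabovStrogatzTownsend2021, §4 proof of Lemma 1, first display (arXiv:2105.11406 p0006)] -/
theorem sum_sin_sub_eq_of_centred {θ : Fin n → ℝ} (hb : ∑ j, Real.sin (θ j) = 0) (j : Fin n) :
    ∑ k, Real.sin (θ k - θ j) = -(∑ k, Real.cos (θ k)) * Real.sin (θ j) := by
  simp only [Real.sin_sub, Finset.sum_sub_distrib]
  have e1 : ∑ k, Real.sin (θ k) * Real.cos (θ j) = (∑ k, Real.sin (θ k)) * Real.cos (θ j) := by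
    rw [Finset.sum_mul]
  have e2 : ∑ k, Real.cos (θ k) * Real.sin (θ j) = (∑ k, Real.cos (θ k)) * Real.sin (θ j) := by
    rw [Finset.sum_mul]
  rw [e1, e2, hb]
  ring

/-- At an equilibrium (`Σₖ Pⱼₖ sin(θⱼ − θₖ) = 0`) of the centred frame the NON-NEIGHBOUR sine sum is
`Σ_{k ≠ j} (1 − Pⱼₖ) sin(θₖ − θⱼ) = −a sin θⱼ`.
[cite: KassabovStrogatzTownsend2021, §4 proof of Lemma 1, first display (arXiv:2105.11406 p0006)] -/
theorem sum_nonneighbour_sin_eq {θ : Fin n → ℝ} (hb : ∑ j, Real.sin (θ j) = 0)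
    (j : Fin n) (hfix : ∑ k, Kur.P j k * Real.sin (θ j - θ k) = 0) :
    ∑ k ∈ Finset.univ.erase j, (1 - Kur.P j k) * Real.sin (θ k - θ j)
      = -(∑ k, Real.cos (θ k)) * Real.sin (θ j) := by
  rw [← sum_sin_sub_eq_of_centred hb j]
  have hfix' : ∑ k, Kur.P j k * Real.sin (θ k - θ j) = 0 := by
    have e : ∑ k, Kur.P j k * Real.sin (θ k - θ j) = -∑ k, Kur.P j k * Real.sin (θ j - θ k) := by
      rw [← Finset.sum_neg_distrib]
      refine Finset.sum_congr rfl fun k _ => ?_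
      rw [show θ k - θ j = -(θ j - θ k) by ring, Real.sin_neg]; ring
    rw [e, hfix, neg_zero]
  have hsplit := Finset.add_sum_erase Finset.univ (fun k => (1 - Kur.P j k) * Real.sin (θ k - θ j))
    (Finset.mem_univ j)
  simp only [sub_self, Real.sin_zero, mul_zero, zero_add] at hsplit
  rw [hsplit]
  have e2 : ∑ k, (1 - Kur.P j k) * Real.sin (θ k - θ j)
      = ∑ k, Real.sin (θ k - θ j) - ∑ k, Kur.P j k * Real.sin (θ k - θ j) := by
    rw [← Finset.sum_sub_distrib]
    exact Finset.sum_congr rfl fun k _ => by ring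
  rw [e2, hfix', sub_zero]

/-- Weighted Cauchy–Schwarz for non-negative weights: `(Σ cₖ sₖ)² ≤ (Σ cₖ)(Σ cₖ sₖ²)`.
[cite: KassabovStrogatzTownsend2021, §4 proof of Lemma 1, eq. (4.2) (arXiv:2105.11406 p0006)] -/
theorem weighted_cauchy_schwarz (s : Finset (Fin n)) (c f : Fin n → ℝ) (hc : ∀ k, 0 ≤ c k) :
    (∑ k ∈ s, c k * f k) ^ 2 ≤ (∑ k ∈ s, c k) * ∑ k ∈ s, c k * f k ^ 2 := by
  have h := Finset.sum_mul_sq_le_sq_mul_sq s (fun k => Real.sqrt (c k)) (fun k => Real.sqrt (c k) * f k)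
  have e1 : ∀ k, Real.sqrt (c k) * (Real.sqrt (c k) * f k) = c k * f k := fun k => by
    rw [← mul_assoc, Real.mul_self_sqrt (hc k)]
  have e2 : ∀ k, Real.sqrt (c k) ^ 2 = c k := fun k => Real.sq_sqrt (hc k)
  have e3 : ∀ k, (Real.sqrt (c k) * f k) ^ 2 = c k * f k ^ 2 := fun k => by
    rw [mul_pow, e2]
  simp only [e1, e2, e3] at h
  exact h

/-- ★ **KST's LEMMA 1** (centred frame `Σ sin θⱼ = 0`, `a = Σ cos θⱼ`; weights `0 ≤ Pⱼₖ ≤ 1`;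
node `j` at equilibrium, with non-neighbour mass `Σ_{k≠j}(1 − Pⱼₖ) ≤ d`):
`(Σ_{k≠j} (1 − Pⱼₖ)|cos(θₖ − θⱼ)|)² ≤ d² − a² sin² θⱼ` — the print's
`n√((1−μ̄)² − ρ₁² sin²θⱼ) ≥ Σₖ(1 − Aⱼₖ)|cos(θₖ − θⱼ)|`, squared and multiplied by `n²`
(`d = n(1 − μ̄)`, `a = nρ₁`). [cite: KassabovStrogatzTownsend2021, §4 Lemma 1 with proof, eqs. (4.1)–(4.2) (arXiv:2105.11406 p0006)] -/
theorem sq_sum_nonneighbour_abs_cos_le {θ : Fin n → ℝ} (hb : ∑ j, Real.sin (θ j) = 0)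
    (hP1 : ∀ j k, Kur.P j k ≤ 1) {d : ℝ} (j : Fin n)
    (hdense : ∑ k ∈ Finset.univ.erase j, (1 - Kur.P j k) ≤ d)
    (hfix : ∑ k, Kur.P j k * Real.sin (θ j - θ k) = 0) :
    (∑ k ∈ Finset.univ.erase j, (1 - Kur.P j k) * |Real.cos (θ k - θ j)|) ^ 2
      ≤ d ^ 2 - (∑ k, Real.cos (θ k)) ^ 2 * Real.sin (θ j) ^ 2 := by
  set a : ℝ := ∑ k, Real.cos (θ k) with ha
  set s : Finset (Fin n) := Finset.univ.erase j with hs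
  set c : Fin n → ℝ := fun k => 1 - Kur.P j k with hc
  have hc0 : ∀ k, 0 ≤ c k := fun k => by rw [hc]; linarith [hP1 j k]
  set m : ℝ := ∑ k ∈ s, c k with hm
  have hm0 : 0 ≤ m := Finset.sum_nonneg fun k _ => hc0 k
  have hmd : m ≤ d := hdense
  -- (Σ c sin)² = a² sin²θⱼ ≤ m · Σ c sin² = m (m − Σ c cos²)
  have hE : ∑ k ∈ s, c k * Real.sin (θ k - θ j) = -a * Real.sin (θ j) :=
    Kur.sum_nonneighbour_sin_eq hb j hfix
  have hcs1 := weighted_cauchy_schwarz s c (fun k => Real.sin (θ k - θ j)) hc0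
  rw [hE] at hcs1
  have hsin2 : ∑ k ∈ s, c k * Real.sin (θ k - θ j) ^ 2 = m - ∑ k ∈ s, c k * Real.cos (θ k - θ j) ^ 2 := by
    rw [hm, ← Finset.sum_sub_distrib]
    refine Finset.sum_congr rfl fun k _ => ?_
    have := Real.sin_sq_add_cos_sq (θ k - θ j)
    linear_combination (c k) * this
  rw [hsin2] at hcs1
  -- (Σ c |cos|)² ≤ m Σ c cos²
  have hcs2 := weighted_cauchy_schwarz s c (fun k => |Real.cos (θ k - θ j)|) hc0
  simp only [sq_abs] at hcs2
  -- combine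
  have h3 : m * ∑ k ∈ s, c k * Real.cos (θ k - θ j) ^ 2 ≤ m ^ 2 - a ^ 2 * Real.sin (θ j) ^ 2 := by
    nlinarith [hcs1]
  have h4 : m ^ 2 ≤ d ^ 2 := by nlinarith [hm0, hmd]
  calc (∑ k ∈ s, c k * |Real.cos (θ k - θ j)|) ^ 2
      ≤ m * ∑ k ∈ s, c k * Real.cos (θ k - θ j) ^ 2 := hcs2
    _ ≤ m ^ 2 - a ^ 2 * Real.sin (θ j) ^ 2 := h3
    _ ≤ d ^ 2 - a ^ 2 * Real.sin (θ j) ^ 2 := by linarith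

/-- **… hence `a|sin θⱼ| ≤ d`** (the print's (4.3) `ρ₁|sin θⱼ| ≤ 1 − μ̄`; `a, d ≥ 0`).
[cite: KassabovStrogatzTownsend2021, §4 eq. (4.3) (arXiv:2105.11406 p0006)] -/
theorem mul_abs_sin_le {θ : Fin n → ℝ} (hb : ∑ j, Real.sin (θ j) = 0)
    (hP1 : ∀ j k, Kur.P j k ≤ 1) {d : ℝ} (hd : 0 ≤ d) (j : Fin n)
    (hdense : ∑ k ∈ Finset.univ.erase j, (1 - Kur.P j k) ≤ d)
    (hfix : ∑ k, Kur.P j k * Real.sin (θ j - θ k) = 0) :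
    (∑ k, Real.cos (θ k)) * |Real.sin (θ j)| ≤ d := by
  have h := Kur.sq_sum_nonneighbour_abs_cos_le hb hP1 j hdense hfix
  have h1 : 0 ≤ d ^ 2 - (∑ k, Real.cos (θ k)) ^ 2 * Real.sin (θ j) ^ 2 := le_trans (sq_nonneg _) h
  have h2 : ((∑ k, Real.cos (θ k)) * |Real.sin (θ j)|) ^ 2 ≤ d ^ 2 := by
    rw [mul_pow, sq_abs]; linarith
  exact (abs_le_of_sq_le_sq' h2 hd).2

/-! ### §4. A large order parameter forces the in-phase state (LXB Prop. 5 / KST Cor. 2) -/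

/-- Trigonometric monotonicity in the right half-plane: if `cos x, cos y > 0` and `sin y ≤ sin x`
then `sin(x − y) ≥ 0`. [folklore] -/
private theorem sin_sub_nonneg_of_sin_le {x y : ℝ} (hx : 0 < Real.cos x) (hy : 0 < Real.cos y)
    (hle : Real.sin y ≤ Real.sin x) : 0 ≤ Real.sin (x - y) := by
  rw [Real.sin_sub]
  have hx1 := Real.sin_sq_add_cos_sq x
  have hy1 := Real.sin_sq_add_cos_sq y
  by_cases hsx : 0 ≤ Real.sin x
  · by_cases hsy : 0 ≤ Real.sin y
    · -- first quadrant: `cos x ≤ cos y`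
      have hsq : Real.cos x ^ 2 ≤ Real.cos y ^ 2 := by
        nlinarith [mul_nonneg (sub_nonneg.2 hle) (add_nonneg hsx hsy)]
      have hc : Real.cos x ≤ Real.cos y := by
        by_contra h
        push Not at h
        nlinarith [mul_pos (add_pos hx hy) (sub_pos.2 h)]
      nlinarith [mul_nonneg hsx (sub_nonneg.2 hc), mul_nonneg hx.le (sub_nonneg.2 hle)]
    · push Not at hsy
      nlinarith [mul_nonneg hsx hy.le, mul_pos hx (neg_pos.2 hsy)]
  · push Not at hsx
    -- fourth quadrant: `cos y ≤ cos x`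
    have hsy : Real.sin y < 0 := lt_of_le_of_lt hle hsx
    have hsq : Real.cos y ^ 2 ≤ Real.cos x ^ 2 := by
      nlinarith [mul_nonneg (sub_nonneg.2 hle) (neg_nonneg.2 (add_neg hsx hsy).le)]
    have hc : Real.cos y ≤ Real.cos x := by
      by_contra h
      push Not at h
      nlinarith [mul_pos (add_pos hx hy) (sub_pos.2 h)]
    nlinarith [mul_nonneg (neg_nonneg.2 hsx.le) (sub_nonneg.2 hc), mul_nonneg hx.le (sub_nonneg.2 hle)]

/-- In the right half-plane `sin(x − y) = 0` forces `sin x = sin y` (and `cos x = cos y`).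
[folklore] -/
private theorem sin_eq_of_sin_sub_eq_zero {x y : ℝ} (hx : 0 < Real.cos x) (hy : 0 < Real.cos y)
    (h0 : Real.sin (x - y) = 0) : Real.sin x = Real.sin y ∧ Real.cos x = Real.cos y := by
  have h1 : Real.cos (x - y) = 1 ∨ Real.cos (x - y) = -1 := by
    have h := Real.sin_sq_add_cos_sq (x - y)
    rw [h0] at h
    have h2 : (Real.cos (x - y) - 1) * (Real.cos (x - y) + 1) = 0 := by nlinarith
    rcases mul_eq_zero.1 h2 with h3 | h3
    · exact Or.inl (by linarith)
    · exact Or.inr (by linarith)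
  have hx1 := Real.sin_sq_add_cos_sq x
  have hy1 := Real.sin_sq_add_cos_sq y
  rcases h1 with h1 | h1
  · -- `cos(x − y) = 1`: the unit vectors coincide
    rw [Real.cos_sub] at h1
    have hsq : (Real.cos x - Real.cos y) ^ 2 + (Real.sin x - Real.sin y) ^ 2 = 0 := by nlinarith
    have hc : Real.cos x - Real.cos y = 0 := by nlinarith [sq_nonneg (Real.cos x - Real.cos y), sq_nonneg (Real.sin x - Real.sin y)]
    have hs : Real.sin x - Real.sin y = 0 := by nlinarith [sq_nonneg (Real.cos x - Real.cos y), sq_nonneg (Real.sin x - Real.sin y)]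
    exact ⟨by linarith, by linarith⟩
  · -- `cos(x − y) = −1` is impossible with both cosines positive
    exfalso
    rw [Real.cos_sub] at h1
    have hsq : (Real.cos x + Real.cos y) ^ 2 + (Real.sin x + Real.sin y) ^ 2 = 0 := by nlinarith
    nlinarith [sq_nonneg (Real.sin x + Real.sin y), mul_pos hx hy]

/-- **An equilibrium confined to an open half-plane is the in-phase state** (connected network,
non-negative weights): if `cos θⱼ > 0` at every node and `Σₖ Pⱼₖ sin(θⱼ − θₖ) = 0` at every node
then `cos(θⱼ − θₖ) = 1` for all `j, k` (the node with the largest `sin θⱼ` pulls all its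
neighbours to its own phase; connectivity propagates). «Let g be any node closest to the edge of
the arc … each of the terms in the sum has the same sign … we cannot have a fixed point» unless
in phase. [cite: TaylorKuramoto2012, §4.2 proof of Theorem 4.2, Case 1 (arXiv:1109.4451 p0012); KassabovStrogatzTownsend2021, §4 Corollary 2 (via Ling–Xu–Bandeira Prop. 5) (arXiv:2105.11406 p0006)] -/
theorem inPhase_of_cos_pos (hP0 : ∀ j k, 0 ≤ Kur.P j k)
    (hconn : ClassicalModel.CouplingConnected Kur.P) {θ : Fin n → ℝ}
    (hcos : ∀ j, 0 < Real.cos (θ j)) (hfix : ∀ j, ∑ k, Kur.P j k * Real.sin (θ j - θ k) = 0)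
    (j k : Fin n) : Real.cos (θ j - θ k) = 1 := by
  -- a node with the largest sine
  obtain ⟨j₀, -, hj₀⟩ := Finset.exists_max_image Finset.univ (fun l => Real.sin (θ l)) ⟨j, Finset.mem_univ j⟩
  set T : Finset (Fin n) := Finset.univ.filter (fun l => Real.sin (θ l) = Real.sin (θ j₀)) with hTdef
  have hT : ∀ l, l ∈ T ↔ Real.sin (θ l) = Real.sin (θ j₀) := fun l => by
    rw [hTdef, Finset.mem_filter]; simp
  -- `T` is closed under coupling
  have hclosed : ∀ l ∈ T, ∀ m, 0 < Kur.P l m → m ∈ T := by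
    intro l hl m hlm
    have hsl : Real.sin (θ l) = Real.sin (θ j₀) := (hT l).1 hl
    have hterm : ∀ k', 0 ≤ Kur.P l k' * Real.sin (θ l - θ k') := fun k' =>
      mul_nonneg (hP0 l k') (sin_sub_nonneg_of_sin_le (hcos l) (hcos k')
        (by rw [hsl]; exact hj₀ k' (Finset.mem_univ _)))
    have hz := (Finset.sum_eq_zero_iff_of_nonneg fun k' _ => hterm k').1 (hfix l) m (Finset.mem_univ m)
    rcases mul_eq_zero.1 hz with h | h
    · exact absurd h hlm.ne'
    · rw [hT, ← hsl]
      exact ((sin_eq_of_sin_sub_eq_zero (hcos l) (hcos m) h).1).symm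
  -- hence `T` is everything
  have hTall : ∀ l, l ∈ T := by
    by_contra hnot
    push Not at hnot
    obtain ⟨m, hm⟩ := hnot
    have hTne : T.Nonempty := ⟨j₀, (hT j₀).2 rfl⟩
    have hTc : Tᶜ.Nonempty := ⟨m, Finset.mem_compl.2 hm⟩
    obtain ⟨l, hl, m', hm', hP⟩ := hconn T hTne hTc
    exact (Finset.mem_compl.1 hm') (hclosed l hl m' hP)
  -- equal sines and positive cosines give equal unit vectors
  have hsj : Real.sin (θ j) = Real.sin (θ j₀) := (hT j).1 (hTall j)
  have hsk : Real.sin (θ k) = Real.sin (θ j₀) := (hT k).1 (hTall k)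
  have hcj := Real.sin_sq_add_cos_sq (θ j)
  have hck := Real.sin_sq_add_cos_sq (θ k)
  have hcc : Real.cos (θ j) = Real.cos (θ k) := by
    have h1 : Real.cos (θ j) ^ 2 = Real.cos (θ k) ^ 2 := by rw [hsj] at hcj; rw [hsk] at hck; linarith
    have h2 : (Real.cos (θ j) - Real.cos (θ k)) * (Real.cos (θ j) + Real.cos (θ k)) = 0 := by nlinarith
    rcases mul_eq_zero.1 h2 with h | h
    · linarith
    · linarith [hcos j, hcos k]
  rw [Real.cos_sub, hcc, hsj, ← hsk]
  nlinarith [hck]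

/-- ★ **KST's COROLLARY 2 (Ling–Xu–Bandeira Prop. 5)** in the centred frame (`Σ sin θⱼ = 0`,
`a = Σ cos θⱼ ≥ 0`; weights `0 ≤ Pⱼₖ ≤ 1`, connected, equilibrium, stability matrix negative
semidefinite, non-neighbour mass `Σ_{k≠j}(1 − Pⱼₖ) ≤ d` at every node): if `a² > 2d²` — the print's
`ρ₁ > √2(1 − μ̄)` — then `θ` is the all-in-phase state. («By (4.3), |sin θⱼ| ≤ (1−μ̄)/ρ₁ < 1/√2 for
all j. Therefore θ must be the all-in-phase state.» Here: the nodes split by the sign of `cos θⱼ`;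
across the split every cosine is negative, so by Taylor's cut lemma one side is empty; `a > 0`
leaves the right half-plane, and `inPhase_of_cos_pos` concludes.)
[cite: KassabovStrogatzTownsend2021, §4 Corollary 2 with (4.3) (arXiv:2105.11406 p0006); TaylorKuramoto2012, §2 Lemma 2.1] -/
theorem inPhase_of_sq_gt (hP0 : ∀ j k, 0 ≤ Kur.P j k) (hP1 : ∀ j k, Kur.P j k ≤ 1)
    (hconn : ClassicalModel.CouplingConnected Kur.P) {θ : Fin n → ℝ}
    (hb : ∑ j, Real.sin (θ j) = 0) (ha : 0 ≤ ∑ k, Real.cos (θ k))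
    (hfix : ∀ j, ∑ k, Kur.P j k * Real.sin (θ j - θ k) = 0)
    (hst : ∀ z : Fin n → ℝ, z ⬝ᵥ ((-Kur.toDroopNetwork.lap θ) *ᵥ z) ≤ 0) {d : ℝ} (hd : 0 ≤ d)
    (hdense : ∀ j, ∑ k ∈ Finset.univ.erase j, (1 - Kur.P j k) ≤ d)
    (hbig : 2 * d ^ 2 < (∑ k, Real.cos (θ k)) ^ 2) (j k : Fin n) :
    Real.cos (θ j - θ k) = 1 := by
  set a : ℝ := ∑ k, Real.cos (θ k) with ha'
  -- every node has `sin² θⱼ < 1/2 < cos² θⱼ`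
  have hsin : ∀ l, 2 * Real.sin (θ l) ^ 2 < 1 := by
    intro l
    have h := Kur.mul_abs_sin_le hb hP1 hd l (hdense l) (hfix l)
    have h2 : a ^ 2 * Real.sin (θ l) ^ 2 ≤ d ^ 2 := by
      have h3 : (a * |Real.sin (θ l)|) ^ 2 ≤ d ^ 2 :=
        pow_le_pow_left₀ (mul_nonneg ha (abs_nonneg _)) h 2
      rw [mul_pow, sq_abs] at h3
      exact h3
    by_contra hge
    push Not at hge
    nlinarith [sq_nonneg (Real.sin (θ l))]
  have hcos2 : ∀ l, 1 < 2 * Real.cos (θ l) ^ 2 := fun l => by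
    have := Real.sin_sq_add_cos_sq (θ l); nlinarith [hsin l]
  have hcos0 : ∀ l, Real.cos (θ l) ≠ 0 := fun l h => by have := hcos2 l; rw [h] at this; norm_num at this
  -- the split by the sign of the cosine; across it every cosine is negative
  set A : Finset (Fin n) := Finset.univ.filter (fun l => 0 < Real.cos (θ l)) with hAdef
  have hA : ∀ l, l ∈ A ↔ 0 < Real.cos (θ l) := fun l => by rw [hAdef, Finset.mem_filter]; simp
  have hcross : ∀ l ∈ A, ∀ m ∈ Aᶜ, Real.cos (θ l - θ m) < 0 := by
    intro l hl m hm
    have hcl : 0 < Real.cos (θ l) := (hA l).1 hl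
    have hcm : Real.cos (θ m) < 0 :=
      lt_of_le_of_ne (not_lt.1 (fun h => (Finset.mem_compl.1 hm) ((hA m).2 h))) (hcos0 m)
    rw [Real.cos_sub]
    -- `|sin l sin m| < 1/2 < |cos l cos m|` and `cos l cos m < 0`
    have h1 : (Real.sin (θ l) * Real.sin (θ m)) ^ 2 < (Real.cos (θ l) * Real.cos (θ m)) ^ 2 := by
      have := hsin l; have := hsin m; have := hcos2 l; have := hcos2 m
      rw [mul_pow, mul_pow]
      nlinarith [sq_nonneg (Real.sin (θ l)), sq_nonneg (Real.sin (θ m))]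
    have h2 : |Real.sin (θ l) * Real.sin (θ m)| < |Real.cos (θ l) * Real.cos (θ m)| := sq_lt_sq.1 h1
    have h3 : |Real.cos (θ l) * Real.cos (θ m)| = -(Real.cos (θ l) * Real.cos (θ m)) :=
      abs_of_neg (mul_neg_of_pos_of_neg hcl hcm)
    have h4 := le_abs_self (Real.sin (θ l) * Real.sin (θ m))
    linarith
  -- so one side is empty (Taylor's cut lemma)
  have hside : A = ∅ ∨ Aᶜ = ∅ := by
    by_contra h
    push Not at h
    have hneg := Kur.cut_neg_of_forall_cos_neg (fun i j _ => hP0 i j) hconn h.1 h.2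
      (fun l hl m hm _ => hcross l hl m hm)
    have hpos := Kur.cut_nonneg_of_stabilityMatrix_negSemidef hst A
    linarith
  -- `A = ∅` would make `a < 0`
  have hn : 0 < n := Fin.pos j
  have hAc0 : Aᶜ = ∅ := by
    rcases hside with h | h
    · exfalso
      have hneg : ∀ l, Real.cos (θ l) < 0 := fun l =>
        lt_of_le_of_ne (not_lt.1 fun hl => by
          have : l ∈ A := (hA l).2 hl
          rw [h] at this
          exact Finset.notMem_empty l this) (hcos0 l)
      have : a < 0 := by
        rw [ha']
        calc ∑ k, Real.cos (θ k) < ∑ _k : Fin n, (0 : ℝ) :=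
              Finset.sum_lt_sum (fun l _ => (hneg l).le) ⟨j, Finset.mem_univ j, hneg j⟩
          _ = 0 := Finset.sum_const_zero
      linarith
    · exact h
  have hall : ∀ l, 0 < Real.cos (θ l) := fun l => by
    by_contra hl
    have : l ∈ Aᶜ := Finset.mem_compl.2 (fun h => hl ((hA l).1 h))
    rw [hAc0] at this
    exact Finset.notMem_empty l this
  have _ := hn
  exact Kur.inPhase_of_cos_pos hP0 hconn hall hfix j k

/-! ### §5. The aggregate inequality (5.1)–(5.2) and the Ling–Xu–Bandeira density bound -/

/-- `|cos x − cos² x| ≤ 2|cos x|` («Since |1 − cos θ| ≤ 2»). [cite: KassabovStrogatzTownsend2021, §5 first display (arXiv:2105.11406 p0007)] -/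
private theorem neg_two_abs_cos_le (x : ℝ) : -(2 * |Real.cos x|) ≤ Real.cos x - Real.cos x ^ 2 := by
  have h1 := Real.abs_cos_le_one x
  have h2 := neg_abs_le (Real.cos x)
  have h3 := le_abs_self (Real.cos x)
  nlinarith [abs_nonneg (Real.cos x), sq_abs (Real.cos x)]

/-- ★ **KST (5.1), unnormalised** (centred frame `Σ sin θⱼ = 0`, `a = Σ cos θⱼ`; weights
`0 ≤ Pⱼₖ ≤ 1`, equilibrium, `M` negative semidefinite, non-neighbour mass `≤ d` at every node):
`a² − (n² + a₂² + b₂²)/2 ≥ −2 Σⱼ √(d² − a² sin²θⱼ)` where `a₂ = Σ cos 2θⱼ`, `b₂ = Σ sin 2θⱼ` — the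
print's `ρ₁² ≥ (1 + |ρ₂|²)/2 − (2/n)Σⱼ√((1−μ̄)² − ρ₁² sin²θⱼ)` times `n²`.
[cite: KassabovStrogatzTownsend2021, §3.1 (3.2)–(3.3) and §5 eq. (5.1) (arXiv:2105.11406 p0005, p0007)] -/
theorem sq_sum_cos_ge_aux (hP0 : ∀ j k, 0 ≤ Kur.P j k) (hP1 : ∀ j k, Kur.P j k ≤ 1)
    {θ : Fin n → ℝ} (hb : ∑ j, Real.sin (θ j) = 0)
    (hfix : ∀ j, ∑ k, Kur.P j k * Real.sin (θ j - θ k) = 0)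
    (hst : ∀ z : Fin n → ℝ, z ⬝ᵥ ((-Kur.toDroopNetwork.lap θ) *ᵥ z) ≤ 0) {d : ℝ}
    (hdense : ∀ j, ∑ k ∈ Finset.univ.erase j, (1 - Kur.P j k) ≤ d) :
    -(2 * ∑ j, Real.sqrt (d ^ 2 - (∑ k, Real.cos (θ k)) ^ 2 * Real.sin (θ j) ^ 2))
      ≤ (∑ k, Real.cos (θ k)) ^ 2
        - ((n : ℝ) ^ 2 + (∑ j, Real.cos (2 * θ j)) ^ 2 + (∑ j, Real.sin (2 * θ j)) ^ 2) / 2 := by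
  set a : ℝ := ∑ k, Real.cos (θ k) with ha
  -- the right-hand side is `ΣΣ (cos − cos²)`
  have hrhs : ∑ j, ∑ k, (Real.cos (θ j - θ k) - Real.cos (θ j - θ k) ^ 2)
      = a ^ 2 - ((n : ℝ) ^ 2 + (∑ j, Real.cos (2 * θ j)) ^ 2 + (∑ j, Real.sin (2 * θ j)) ^ 2) / 2 := by
    simp only [Finset.sum_sub_distrib]
    rw [sum_sum_cos_sub_eq, sum_sum_cos_sub_sq_eq, hb]
    ring
  -- LXB: the coupled part is non-negative, so the uncoupled part is at most the total
  have hLXB := Kur.sum_sum_weight_cos_mul_one_sub_cos_nonneg hst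
  have hsplit : ∑ j, ∑ k, (1 - Kur.P j k) * (Real.cos (θ j - θ k) - Real.cos (θ j - θ k) ^ 2)
      = ∑ j, ∑ k, (Real.cos (θ j - θ k) - Real.cos (θ j - θ k) ^ 2)
        - ∑ j, ∑ k, Kur.P j k * Real.cos (θ j - θ k) * (1 - Real.cos (θ j - θ k)) := by
    rw [← Finset.sum_sub_distrib]
    refine Finset.sum_congr rfl fun j _ => ?_
    rw [← Finset.sum_sub_distrib]
    exact Finset.sum_congr rfl fun k _ => by ring
  -- the uncoupled part is at least `−2 Σⱼ Σ_{k≠j} (1 − P)|cos|`, and each inner sum is Lemma 1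
  have hlow : ∀ j, -(2 * Real.sqrt (d ^ 2 - a ^ 2 * Real.sin (θ j) ^ 2))
      ≤ ∑ k, (1 - Kur.P j k) * (Real.cos (θ j - θ k) - Real.cos (θ j - θ k) ^ 2) := by
    intro j
    -- drop the (vanishing) diagonal term
    have hdiag : ∑ k, (1 - Kur.P j k) * (Real.cos (θ j - θ k) - Real.cos (θ j - θ k) ^ 2)
        = ∑ k ∈ Finset.univ.erase j,
            (1 - Kur.P j k) * (Real.cos (θ j - θ k) - Real.cos (θ j - θ k) ^ 2) := by
      rw [← Finset.add_sum_erase Finset.univ _ (Finset.mem_univ j)]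
      simp
    rw [hdiag]
    have hterm : ∀ k ∈ Finset.univ.erase j,
        -(2 * ((1 - Kur.P j k) * |Real.cos (θ k - θ j)|))
          ≤ (1 - Kur.P j k) * (Real.cos (θ j - θ k) - Real.cos (θ j - θ k) ^ 2) := by
      intro k _
      have hc : 0 ≤ 1 - Kur.P j k := by linarith [hP1 j k]
      have h := neg_two_abs_cos_le (θ j - θ k)
      have hsym : |Real.cos (θ k - θ j)| = |Real.cos (θ j - θ k)| := by
        rw [← Real.cos_neg, neg_sub]
      rw [hsym]
      nlinarith [abs_nonneg (Real.cos (θ j - θ k))]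
    have hsum := Finset.sum_le_sum hterm
    have hL := Kur.sq_sum_nonneighbour_abs_cos_le hb hP1 j (hdense j) (hfix j)
    have hS0 : 0 ≤ ∑ k ∈ Finset.univ.erase j, (1 - Kur.P j k) * |Real.cos (θ k - θ j)| :=
      Finset.sum_nonneg fun k _ => mul_nonneg (by linarith [hP1 j k]) (abs_nonneg _)
    have hsqrt : ∑ k ∈ Finset.univ.erase j, (1 - Kur.P j k) * |Real.cos (θ k - θ j)|
        ≤ Real.sqrt (d ^ 2 - a ^ 2 * Real.sin (θ j) ^ 2) := Real.le_sqrt_of_sq_le hL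
    calc -(2 * Real.sqrt (d ^ 2 - a ^ 2 * Real.sin (θ j) ^ 2))
        ≤ -(2 * ∑ k ∈ Finset.univ.erase j, (1 - Kur.P j k) * |Real.cos (θ k - θ j)|) := by
          linarith
      _ = ∑ k ∈ Finset.univ.erase j, -(2 * ((1 - Kur.P j k) * |Real.cos (θ k - θ j)|)) := by
          rw [Finset.mul_sum, ← Finset.sum_neg_distrib]
      _ ≤ _ := hsum
  have hlowsum := Finset.sum_le_sum fun j (_ : j ∈ Finset.univ) => hlow j
  rw [Finset.sum_neg_distrib, ← Finset.mul_sum] at hlowsum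
  have _ := hP0
  rw [← hrhs]
  linarith [hLXB, hsplit, hlowsum]

/-- ★ **KST (5.2), unnormalised**: under the same hypotheses and `d ≥ 0`,
`a² ≥ n²/2 − 2nd + (a₂² + b₂²)/2` — the print's `ρ₁² ≥ 2(μ̄ − 3/4) + ½|ρ₂|²` times `n²`
(`√(d² − a²sin²θⱼ) ≤ d`). [cite: KassabovStrogatzTownsend2021, §5 eq. (5.2) (arXiv:2105.11406 p0007) («also implies the one found by Ling, Xu, and Bandeira (see [5.4] in their paper)»)] -/
theorem sq_sum_cos_ge (hP0 : ∀ j k, 0 ≤ Kur.P j k) (hP1 : ∀ j k, Kur.P j k ≤ 1)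
    {θ : Fin n → ℝ} (hb : ∑ j, Real.sin (θ j) = 0)
    (hfix : ∀ j, ∑ k, Kur.P j k * Real.sin (θ j - θ k) = 0)
    (hst : ∀ z : Fin n → ℝ, z ⬝ᵥ ((-Kur.toDroopNetwork.lap θ) *ᵥ z) ≤ 0) {d : ℝ} (hd : 0 ≤ d)
    (hdense : ∀ j, ∑ k ∈ Finset.univ.erase j, (1 - Kur.P j k) ≤ d) :
    (n : ℝ) ^ 2 / 2 - 2 * n * d + ((∑ j, Real.cos (2 * θ j)) ^ 2 + (∑ j, Real.sin (2 * θ j)) ^ 2) / 2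
      ≤ (∑ k, Real.cos (θ k)) ^ 2 := by
  have h := Kur.sq_sum_cos_ge_aux hP0 hP1 hb hfix hst hdense
  have hsq : ∀ j, Real.sqrt (d ^ 2 - (∑ k, Real.cos (θ k)) ^ 2 * Real.sin (θ j) ^ 2) ≤ d := by
    intro j
    rw [Real.sqrt_le_left hd]
    nlinarith [sq_nonneg ((∑ k, Real.cos (θ k)) * Real.sin (θ j))]
  have hsum : ∑ j, Real.sqrt (d ^ 2 - (∑ k, Real.cos (θ k)) ^ 2 * Real.sin (θ j) ^ 2)
      ≤ ∑ _j : Fin n, d := Finset.sum_le_sum fun j _ => hsq j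
  simp only [Finset.sum_const, Finset.card_univ, Fintype.card_fin, nsmul_eq_mul] at hsum
  linarith

/-- ★★ **THE LING–XU–BANDEIRA DENSITY BOUND** (centred frame, connected network, `0 ≤ Pⱼₖ ≤ 1`,
equilibrium with negative semidefinite stability matrix, non-neighbour mass `≤ d` at every node):
if `4d² + 4nd < n²` — i.e. `d/n < (√2 − 1)/2`, the print's `μ̄ > 0.7929` — then `θ` is the
all-in-phase state (`a² ≥ n²/2 − 2nd > 2d²` and Corollary 2).
[cite: KassabovStrogatzTownsend2021, §1 («Ling, Xu, and Bandeira strengthened Taylor's result to show that μ_c ≤ 0.7929») and §5 (5.2) with Corollary 2 (arXiv:2105.11406 p0003, p0006–p0007)] -/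
theorem inPhase_of_dense_LXB (hP0 : ∀ j k, 0 ≤ Kur.P j k) (hP1 : ∀ j k, Kur.P j k ≤ 1)
    (hconn : ClassicalModel.CouplingConnected Kur.P) {θ : Fin n → ℝ}
    (hb : ∑ j, Real.sin (θ j) = 0) (ha : 0 ≤ ∑ k, Real.cos (θ k))
    (hfix : ∀ j, ∑ k, Kur.P j k * Real.sin (θ j - θ k) = 0)
    (hst : ∀ z : Fin n → ℝ, z ⬝ᵥ ((-Kur.toDroopNetwork.lap θ) *ᵥ z) ≤ 0) {d : ℝ} (hd : 0 ≤ d)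
    (hdense : ∀ j, ∑ k ∈ Finset.univ.erase j, (1 - Kur.P j k) ≤ d)
    (hLXB : 4 * d ^ 2 + 4 * n * d < (n : ℝ) ^ 2) (j k : Fin n) :
    Real.cos (θ j - θ k) = 1 := by
  have h := Kur.sq_sum_cos_ge hP0 hP1 hb hfix hst hd hdense
  refine Kur.inPhase_of_sq_gt hP0 hP1 hconn hb ha hfix hst hd hdense ?_ j k
  nlinarith [sq_nonneg (∑ j, Real.cos (2 * θ j)), sq_nonneg (∑ j, Real.sin (2 * θ j))]

/-! ### §6. KST's Lemmas 3–4 and Theorem 5 in the centred frame: `4d < n` forces the in-phase state -/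

/-- AM–GM for square roots (the tangent line of the concave `√`): `2√y₀√y ≤ y₀ + y`.
[cite: KassabovStrogatzTownsend2021, §5 proof of Lemma 3 («intersect tangentially at x = x₀ … the concavity of the function») (arXiv:2105.11406 p0007)] -/
private theorem two_mul_sqrt_mul_sqrt_le {y y₀ : ℝ} (hy : 0 ≤ y) (hy₀ : 0 ≤ y₀) :
    2 * (Real.sqrt y₀ * Real.sqrt y) ≤ y₀ + y := by
  have h1 := Real.sq_sqrt hy
  have h2 := Real.sq_sqrt hy₀
  nlinarith [sq_nonneg (Real.sqrt y - Real.sqrt y₀)]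

/-- ★★★ **KST's THEOREM 5 in the centred frame** (`Σ sin θⱼ = 0`, `a = Σ cos θⱼ ≥ 0`; connected
network with weights `0 ≤ Pⱼₖ ≤ 1`; `θ` an equilibrium, `Σₖ Pⱼₖ sin(θⱼ − θₖ) = 0`, whose stability
matrix `M(θ) = −L(θ)` is negative semidefinite; every node has non-neighbour mass
`Σ_{k≠j}(1 − Pⱼₖ) ≤ d` with `4d < n` — the print's `μ̄ > 3/4`): `θ` is the all-in-phase state.
PROOF AS PRINTED: if `2a² > n²` (`ρ₁² > ½`) Corollary 2 applies at once; otherwise Lemma 3 at the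
optimal tangent point `x₀*` (here `y₀ = d² − a²x₀* = (n² − 2a²)²/(16n²)`, the pointwise tangent
inequality being AM–GM `2√y₀√yⱼ ≤ y₀ + yⱼ` with `yⱼ = d² − a²sin²θⱼ`) and (5.1) give
`a²·Σcos 2θⱼ ≥ na² − 2nd² + (n² − 2a²)²/(8n) ≥ na²/2` (Lemma 4: `|ρ₂| ≥ ½`, using `16d² < n²`),
whence `(Σcos 2θⱼ)² ≥ n²/4` and by (5.2) `a² ≥ n²/2 − 2nd + n²/8 > 2d²`: Corollary 2 again.
[cite: KassabovStrogatzTownsend2021, §5 Lemma 3 (5.3)–(5.6), Lemma 4, Theorem 5 (arXiv:2105.11406 p0007–p0008)] -/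
theorem inPhase_of_dense_centred (hP0 : ∀ j k, 0 ≤ Kur.P j k) (hP1 : ∀ j k, Kur.P j k ≤ 1)
    (hconn : ClassicalModel.CouplingConnected Kur.P) {θ : Fin n → ℝ}
    (hb : ∑ j, Real.sin (θ j) = 0) (ha : 0 ≤ ∑ k, Real.cos (θ k))
    (hfix : ∀ j, ∑ k, Kur.P j k * Real.sin (θ j - θ k) = 0)
    (hst : ∀ z : Fin n → ℝ, z ⬝ᵥ ((-Kur.toDroopNetwork.lap θ) *ᵥ z) ≤ 0) {d : ℝ} (hd : 0 ≤ d)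
    (hdense : ∀ j, ∑ k ∈ Finset.univ.erase j, (1 - Kur.P j k) ≤ d)
    (h4d : 4 * d < (n : ℝ)) (j k : Fin n) :
    Real.cos (θ j - θ k) = 1 := by
  have hNpos : 0 < (n : ℝ) := by exact_mod_cast Fin.pos j
  have hd2 : 16 * d ^ 2 < (n : ℝ) ^ 2 := by nlinarith
  have hNd : 2 * (n : ℝ) * d < (n : ℝ) ^ 2 / 2 := by nlinarith
  have h52 := Kur.sq_sum_cos_ge hP0 hP1 hb hfix hst hd hdense
  have h51 := Kur.sq_sum_cos_ge_aux hP0 hP1 hb hfix hst hdense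
  refine Kur.inPhase_of_sq_gt hP0 hP1 hconn hb ha hfix hst hd hdense ?_ j k
  -- goal: `2 d² < a²`
  set a : ℝ := ∑ k, Real.cos (θ k) with ha'
  set a2 : ℝ := ∑ j, Real.cos (2 * θ j) with ha2
  set b2 : ℝ := ∑ j, Real.sin (2 * θ j) with hb2
  have hdsq : 0 ≤ d ^ 2 := sq_nonneg d
  by_cases hbig : (n : ℝ) ^ 2 < 2 * a ^ 2
  · linarith
  · push Not at hbig
    have hq0 : 0 ≤ a2 ^ 2 + b2 ^ 2 := by positivity
    -- `a² > 0`
    have hapos : 0 < a ^ 2 := by linarith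
    -- the tangent point: `y₀ = (n² − 2a²)²/(16n²) = d² − a²x₀`, `x₀ ≥ 0`
    set y₀ : ℝ := ((n : ℝ) ^ 2 - 2 * a ^ 2) ^ 2 / (16 * (n : ℝ) ^ 2) with hy₀
    have hy₀0 : 0 ≤ y₀ := by positivity
    have hsqrt_y₀ : Real.sqrt y₀ = ((n : ℝ) ^ 2 - 2 * a ^ 2) / (4 * n) := by
      rw [hy₀, show ((n : ℝ) ^ 2 - 2 * a ^ 2) ^ 2 / (16 * (n : ℝ) ^ 2)
        = (((n : ℝ) ^ 2 - 2 * a ^ 2) / (4 * n)) ^ 2 by field_simp; ring]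
      exact Real.sqrt_sq (div_nonneg (by linarith) (by linarith))
    -- pointwise tangent inequality: `a² cos 2θⱼ ≥ a² − 2d² − 2y₀ + 4√y₀ √yⱼ`
    have hpt : ∀ l, a ^ 2 - 2 * d ^ 2 - 2 * y₀
        + 4 * (Real.sqrt y₀ * Real.sqrt (d ^ 2 - a ^ 2 * Real.sin (θ l) ^ 2))
        ≤ a ^ 2 * Real.cos (2 * θ l) := by
      intro l
      have hyl : 0 ≤ d ^ 2 - a ^ 2 * Real.sin (θ l) ^ 2 := by
        have h := Kur.mul_abs_sin_le hb hP1 hd l (hdense l) (hfix l)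
        have h3 : (a * |Real.sin (θ l)|) ^ 2 ≤ d ^ 2 :=
          pow_le_pow_left₀ (mul_nonneg ha (abs_nonneg _)) h 2
        rw [mul_pow, sq_abs] at h3
        linarith
      have ham := two_mul_sqrt_mul_sqrt_le hyl hy₀0
      have hcos2 : Real.cos (2 * θ l) = 1 - 2 * Real.sin (θ l) ^ 2 := by
        rw [Real.cos_two_mul, Real.cos_sq']; ring
      rw [hcos2]
      linarith
    have hsum := Finset.sum_le_sum fun l (_ : l ∈ Finset.univ) => hpt l
    rw [← Finset.mul_sum] at hsum
    simp only [Finset.sum_add_distrib, Finset.sum_sub_distrib, Finset.sum_const, Finset.card_univ,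
      Fintype.card_fin, nsmul_eq_mul, ← Finset.mul_sum] at hsum
    -- combine with (5.1) (`2 Σ √yⱼ ≥ (n² + q²)/2 − a²`): `a² a2 ≥ n a² − 2n d² + 2n y₀`
    have hS0 : 0 ≤ ∑ l, Real.sqrt (d ^ 2 - a ^ 2 * Real.sin (θ l) ^ 2) :=
      Finset.sum_nonneg fun l _ => Real.sqrt_nonneg _
    have h1 : Real.sqrt y₀ * ((n : ℝ) ^ 2 - 2 * a ^ 2) = 4 * n * y₀ := by
      rw [hsqrt_y₀, hy₀]; field_simp; ring
    have h3 : (n : ℝ) ^ 2 - 2 * a ^ 2 ≤ 4 * ∑ l, Real.sqrt (d ^ 2 - a ^ 2 * Real.sin (θ l) ^ 2) := by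
      linarith
    have h2 : Real.sqrt y₀ * ((n : ℝ) ^ 2 - 2 * a ^ 2)
        ≤ Real.sqrt y₀ * (4 * ∑ l, Real.sqrt (d ^ 2 - a ^ 2 * Real.sin (θ l) ^ 2)) :=
      mul_le_mul_of_nonneg_left h3 (Real.sqrt_nonneg y₀)
    have hkey : (n : ℝ) * a ^ 2 - 2 * n * d ^ 2 + 2 * n * y₀ ≤ a ^ 2 * a2 := by
      linarith
    -- Lemma 4: `a² a2 ≥ n a²/2`, hence `a2 ≥ n/2`
    have hy₀val : 2 * (n : ℝ) * y₀ = ((n : ℝ) ^ 2 - 2 * a ^ 2) ^ 2 / (8 * n) := by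
      rw [hy₀]; field_simp; ring
    have hL4 : (n : ℝ) * a ^ 2 / 2 ≤ (n : ℝ) * a ^ 2 - 2 * n * d ^ 2 + 2 * n * y₀ := by
      rw [hy₀val]
      have e1 : 0 ≤ (n : ℝ) ^ 4 + 4 * a ^ 4 - 16 * (n : ℝ) ^ 2 * d ^ 2 := by
        have : 16 * (n : ℝ) ^ 2 * d ^ 2 ≤ (n : ℝ) ^ 2 * (n : ℝ) ^ 2 :=
          by nlinarith [sq_nonneg (n : ℝ)]
        nlinarith [sq_nonneg (a ^ 2)]
      have e2 : (n : ℝ) * a ^ 2 - 2 * n * d ^ 2 + ((n : ℝ) ^ 2 - 2 * a ^ 2) ^ 2 / (8 * n)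
          - (n : ℝ) * a ^ 2 / 2
          = ((n : ℝ) ^ 4 + 4 * a ^ 4 - 16 * (n : ℝ) ^ 2 * d ^ 2) / (8 * n) := by
        field_simp; ring
      have e3 : 0 ≤ ((n : ℝ) ^ 4 + 4 * a ^ 4 - 16 * (n : ℝ) ^ 2 * d ^ 2) / (8 * n) := by positivity
      linarith
    have ha2 : (n : ℝ) / 2 ≤ a2 := by
      have e1 : a ^ 2 * ((n : ℝ) / 2) ≤ a ^ 2 * a2 := by linarith
      exact le_of_mul_le_mul_left e1 hapos
    have ha2sq : (n : ℝ) ^ 2 / 4 ≤ a2 ^ 2 := by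
      have e1 := pow_le_pow_left₀ (by linarith : 0 ≤ (n : ℝ) / 2) ha2 2
      have e2 : ((n : ℝ) / 2) ^ 2 = (n : ℝ) ^ 2 / 4 := by ring
      rw [e2] at e1
      exact e1
    -- (5.2) with `q² ≥ n²/4`: `a² ≥ n²/2 − 2nd + n²/8 > 2d²`
    have hb2 : 0 ≤ b2 ^ 2 := sq_nonneg _
    linarith

/-! ### §7. Theorem 5 in any frame, for the model, and with «stable» = Lyapunov stable -/

/-- The linearised Laplacian sees only phase differences: `L(θ − ψ𝟙) = L(θ)`.
[cite: KassabovStrogatzTownsend2021, §3 («(1.1) is invariant under a global shift of all phases by ψ») (arXiv:2105.11406 p0005)] -/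
theorem lap_sub_const (θ : Fin n → ℝ) (ψ : ℝ) :
    Kur.toDroopNetwork.lap (fun j => θ j - ψ) = Kur.toDroopNetwork.lap θ := by
  have hw : ∀ i j, Kur.toDroopNetwork.linWeight (fun j => θ j - ψ) i j
      = Kur.toDroopNetwork.linWeight θ i j := by
    intro i j
    rw [Kur.toDroopNetwork_linWeight, Kur.toDroopNetwork_linWeight, sub_sub_sub_cancel_right]
  funext i j
  simp only [DroopNetwork.lap, hw]

/-- **Density forces connectivity**: symmetric weights `0 ≤ Pⱼₖ ≤ 1` with non-neighbour mass
`Σ_{k≠j}(1 − Pⱼₖ) ≤ d` at every node and `2d < n` make the coupling graph connected («any network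
with node degrees at least ½(n−1) must be connected»).
[cite: TaylorKuramoto2012, §4.2 proof of Theorem 4.2, Case 1 (arXiv:1109.4451 p0012)] -/
theorem couplingConnected_of_dense (hP0 : ∀ j k, 0 ≤ Kur.P j k) (hP1 : ∀ j k, Kur.P j k ≤ 1)
    (hPs : ∀ j k, Kur.P j k = Kur.P k j) {d : ℝ}
    (hdense : ∀ j, ∑ k ∈ Finset.univ.erase j, (1 - Kur.P j k) ≤ d) (h2d : 2 * d < (n : ℝ)) :
    ClassicalModel.CouplingConnected Kur.P := by
  intro S hS hSc
  by_contra h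
  push Not at h
  -- every line across the cut is absent
  have hzero : ∀ i ∈ S, ∀ j ∈ Sᶜ, Kur.P i j = 0 :=
    fun i hi j hj => le_antisymm (h i hi j hj) (hP0 i j)
  -- so each side is at most `d` in size
  have hbound : ∀ (A : Finset (Fin n)) (i : Fin n), i ∉ A → (∀ j ∈ A, Kur.P i j = 0) →
      (A.card : ℝ) ≤ d := by
    intro A i hi hA
    have hsub : A ⊆ Finset.univ.erase i := fun j hj =>
      Finset.mem_erase.2 ⟨fun h => hi (h ▸ hj), Finset.mem_univ j⟩
    calc (A.card : ℝ) = ∑ j ∈ A, (1 - Kur.P i j) := by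
          rw [Finset.sum_congr rfl fun j hj => by rw [hA j hj, sub_zero]]
          simp
      _ ≤ ∑ j ∈ Finset.univ.erase i, (1 - Kur.P i j) :=
          Finset.sum_le_sum_of_subset_of_nonneg hsub fun j _ _ => by linarith [hP1 i j]
      _ ≤ d := hdense i
  obtain ⟨i, hi⟩ := hS
  obtain ⟨j, hj⟩ := hSc
  have h1 : (Sᶜ.card : ℝ) ≤ d := hbound Sᶜ i (fun h => (Finset.mem_compl.1 h) hi) (hzero i hi)
  have h2 : (S.card : ℝ) ≤ d := hbound S j (Finset.mem_compl.1 hj)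
    (fun k hk => by rw [hPs]; exact hzero k hk j hj)
  have hcard : (S.card : ℝ) + Sᶜ.card = n := by
    have h := Finset.card_add_card_compl S
    rw [Fintype.card_fin] at h
    exact_mod_cast h
  linarith

/-- ★★★ **KST's THEOREM 5, print's notion, any frame**: on a network with symmetric weights
`0 ≤ Pⱼₖ ≤ 1` in which every node has non-neighbour mass `Σ_{k≠j}(1 − Pⱼₖ) ≤ d` with `4d < n` (for
a simple graph: fewer than `n/4` non-neighbours, i.e. degree `> 3n/4 − 1`, the print's `μ̄ > 3/4`),
every solution of the homogeneous fixed-point equations `Σₖ Pⱼₖ sin(θⱼ − θₖ) = 0` whose stability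
matrix `M(θ) = −L(θ)` is negative semidefinite is the all-in-phase state. (Rotate to the centred
frame by the argument `ψ` of the order parameter `Σⱼ e^{iθⱼ}` — «we may assume that the complex
order parameter ρ₁ is real-valued and non-negative» — and apply `inPhase_of_dense_centred`.)
[cite: KassabovStrogatzTownsend2021, Theorem 5 with §3 (normalisation ψ = 0) and §2 (eq:TightestBound) (arXiv:2105.11406 p0004–p0005, p0008)] -/
theorem inPhase_of_dense (hP0 : ∀ j k, 0 ≤ Kur.P j k) (hP1 : ∀ j k, Kur.P j k ≤ 1)
    (hPs : ∀ j k, Kur.P j k = Kur.P k j) {θ : Fin n → ℝ}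
    (hfix : ∀ j, ∑ k, Kur.P j k * Real.sin (θ j - θ k) = 0)
    (hst : ∀ z : Fin n → ℝ, z ⬝ᵥ ((-Kur.toDroopNetwork.lap θ) *ᵥ z) ≤ 0) {d : ℝ} (hd : 0 ≤ d)
    (hdense : ∀ j, ∑ k ∈ Finset.univ.erase j, (1 - Kur.P j k) ≤ d)
    (h4d : 4 * d < (n : ℝ)) (j k : Fin n) :
    Real.cos (θ j - θ k) = 1 := by
  have hconn := Kur.couplingConnected_of_dense hP0 hP1 hPs hdense (by linarith)
  -- rotate by the argument of the order parameter
  set a₀ : ℝ := ∑ l, Real.cos (θ l) with ha₀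
  set b₀ : ℝ := ∑ l, Real.sin (θ l) with hb₀
  obtain ⟨ψ, hψb, hψa⟩ : ∃ ψ : ℝ, b₀ * Real.cos ψ - a₀ * Real.sin ψ = 0
      ∧ 0 ≤ a₀ * Real.cos ψ + b₀ * Real.sin ψ := by
    by_cases hz : (⟨a₀, b₀⟩ : ℂ) = 0
    · have ha : a₀ = 0 := by have := congrArg Complex.re hz; simpa using this
      have hb : b₀ = 0 := by have := congrArg Complex.im hz; simpa using this
      exact ⟨0, by rw [ha, hb]; simp, by rw [ha, hb]; simp⟩
    · refine ⟨Complex.arg ⟨a₀, b₀⟩, ?_, ?_⟩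
      · rw [Complex.cos_arg hz, Complex.sin_arg]
        simp only
        ring
      · rw [Complex.cos_arg hz, Complex.sin_arg]
        simp only
        have hn : 0 < ‖(⟨a₀, b₀⟩ : ℂ)‖ := norm_pos_iff.2 hz
        have e : a₀ * (a₀ / ‖(⟨a₀, b₀⟩ : ℂ)‖) + b₀ * (b₀ / ‖(⟨a₀, b₀⟩ : ℂ)‖)
            = (a₀ ^ 2 + b₀ ^ 2) / ‖(⟨a₀, b₀⟩ : ℂ)‖ := by
          field_simp
        rw [e]
        exact div_nonneg (by positivity) hn.le
  set θ' : Fin n → ℝ := fun l => θ l - ψ with hθ'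
  have hdiff : ∀ l m, θ' l - θ' m = θ l - θ m := fun l m => by simp only [hθ']; ring
  -- the rotated configuration is centred
  have hb' : ∑ l, Real.sin (θ' l) = 0 := by
    simp only [hθ', Real.sin_sub, Finset.sum_sub_distrib, ← Finset.sum_mul]
    linarith
  have ha' : 0 ≤ ∑ l, Real.cos (θ' l) := by
    simp only [hθ', Real.cos_sub, Finset.sum_add_distrib, ← Finset.sum_mul]
    linarith
  have hfix' : ∀ l, ∑ m, Kur.P l m * Real.sin (θ' l - θ' m) = 0 := fun l => by
    simp only [hdiff]; exact hfix l
  have hst' : ∀ z : Fin n → ℝ, z ⬝ᵥ ((-Kur.toDroopNetwork.lap θ') *ᵥ z) ≤ 0 := by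
    rw [hθ', Kur.lap_sub_const]; exact hst
  have h := Kur.inPhase_of_dense_centred hP0 hP1 hconn hb' ha' hfix' hst' hd hdense h4d j k
  rwa [hdiff] at h

/-- At a phase-locked state of the lossless model with homogeneous (specific) natural frequencies
`ωⱼ = Dⱼc` the homogeneous fixed-point equations hold: `Σₖ Pⱼₖ sin(θⱼ − θₖ) = 0` («By going into a
rotating frame at this frequency, we can set ω = 0»).
[cite: KassabovStrogatzTownsend2021, §1 eq. (1.1) (arXiv:2105.11406 p0003); TaylorKuramoto2012, §3 (arXiv:1109.4451 p0009)] -/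
theorem sum_weight_sin_eq_zero_of_locked (hD : ∀ i, 0 < Kur.D i) {c : ℝ}
    (hω : ∀ i, Kur.ω i = Kur.D i * c) (hφ : ∀ i j, Kur.φ i j = 0) {θ : Fin n → ℝ}
    (hθ : ∀ i, Kur.field θ i = (∑ j, Kur.ω j) / ∑ j, Kur.D j) (m : Fin n) :
    ∑ j, Kur.P m j * Real.sin (θ m - θ j) = 0 := by
  have hn : 0 < n := Fin.pos m
  have h := hθ m
  rw [Kur.complete_syncFreq_eq c hD hω hn] at h
  unfold field at h
  rw [div_eq_iff (hD m).ne', hω m] at h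
  simp only [hφ, add_zero] at h
  linarith

/-- ★★★ **SUFFICIENTLY DENSE KURAMOTO NETWORKS HAVE NO STABLE PATTERN (KST 2021 Theorem 5), in the
first-order model with the print's notion of stability.** First-order Kuramoto network
`Dⱼθ̇ⱼ = ωⱼ − Σₖ Pⱼₖ sin(θⱼ − θₖ)` with symmetric weights `0 ≤ Pⱼₖ ≤ 1` (print: `Aⱼₖ ∈ {0,1}`),
identical specific natural frequencies `ωⱼ = Dⱼc` (print: `Dⱼ = 1`, `ωⱼ ≡ ω`), any `Dⱼ > 0`; every
node has fewer than `n/4` non-neighbours by weight: `4·Σ_{k≠j}(1 − Pⱼₖ) < n` (the print's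
connectivity `μ̄ > 3/4`; for a simple graph: minimum degree `> 3n/4 − 1`, eq. (2.2)). Then a
phase-locked state `θ` whose stability matrix `M(θ) = −L(θ)` is negative semidefinite — «stable»
by linear analysis — is the all-in-phase state: `cos(θⱼ − θₖ) = 1` for all `j, k`. «If μ̄ > 3/4,
then the only stable equilibrium is the all-in-phase state.»
[cite: KassabovStrogatzTownsend2021, Theorem 5 and §2 eq. (2.2) (arXiv:2105.11406 p0004, p0008)] -/
theorem dense_cos_eq_one_of_stabilityMatrix_negSemidef (hD : ∀ i, 0 < Kur.D i)
    (hP0 : ∀ j k, 0 ≤ Kur.P j k) (hP1 : ∀ j k, Kur.P j k ≤ 1)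
    (hPs : ∀ j k, Kur.P j k = Kur.P k j) {c : ℝ} (hω : ∀ i, Kur.ω i = Kur.D i * c)
    (hφ : ∀ i j, Kur.φ i j = 0)
    (hdense : ∀ j, 4 * ∑ k ∈ Finset.univ.erase j, (1 - Kur.P j k) < (n : ℝ))
    {θ : Fin n → ℝ} (hθ : ∀ i, Kur.field θ i = (∑ j, Kur.ω j) / ∑ j, Kur.D j)
    (hst : ∀ z : Fin n → ℝ, z ⬝ᵥ ((-Kur.toDroopNetwork.lap θ) *ᵥ z) ≤ 0) (j k : Fin n) :
    Real.cos (θ j - θ k) = 1 := by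
  -- a uniform bound `d` = the largest non-neighbour mass
  have hne : (Finset.univ : Finset (Fin n)).Nonempty := ⟨j, Finset.mem_univ j⟩
  set d : ℝ := Finset.univ.sup' hne (fun l => ∑ m ∈ Finset.univ.erase l, (1 - Kur.P l m)) with hd
  have hdense' : ∀ l, ∑ m ∈ Finset.univ.erase l, (1 - Kur.P l m) ≤ d :=
    fun l => Finset.le_sup' (fun l => ∑ m ∈ Finset.univ.erase l, (1 - Kur.P l m)) (Finset.mem_univ l)
  have hd0 : 0 ≤ d := le_trans (Finset.sum_nonneg fun m _ => by linarith [hP1 j m]) (hdense' j)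
  have h4d : 4 * d < (n : ℝ) := by
    obtain ⟨l, -, hl⟩ := Finset.exists_mem_eq_sup' hne (fun l => ∑ m ∈ Finset.univ.erase l, (1 - Kur.P l m))
    rw [hd, hl]
    exact hdense l
  exact Kur.inPhase_of_dense hP0 hP1 hPs (Kur.sum_weight_sin_eq_zero_of_locked hD hω hφ hθ) hst hd0
    hdense' h4d j k

/-- ★★★ **KST's THEOREM 5 WITH «STABLE» = LYAPUNOV STABLE — the dichotomy** (same network and model,
`Dⱼ > 0`): a phase-locked state `θ` has a LYAPUNOV-STABLE locked solution `t ↦ θ + ω_sync t𝟙` (every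
motion from every `δ`-close phase vector stays in the `ε`-tube for all `t ≥ 0`; motions exist from
every phase vector, `exists_globalSolution`) IF AND ONLY IF it is the all-in-phase state. (⇒) a
Lyapunov-stable locked solution has a negative semidefinite stability matrix
(`stabilityMatrix_negSemidef_of_lockedSolution_stable`, Lyapunov's indirect method), then Theorem 5;
(⇐) the in-phase state is in normal operation on a connected network (density ⇒ connectivity), hence
locally exponentially stable modulo rotation (MTW Cor. 1, gridfusion-lit-2). «The system is guaranteed
to converge to the all-in-phase synchronous state» is the print's almost-global claim for the gradient
flow and is NOT asserted here.
[cite: KassabovStrogatzTownsend2021, Theorem 5 (arXiv:2105.11406 p0008); ManikTimmeWitthaut2017, §3 Lemma 1 and Cor. 1; Khalil2002, Theorem 4.7] -/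
theorem dense_lockedSolution_stable_iff_inPhase (hD : ∀ i, 0 < Kur.D i)
    (hP0 : ∀ j k, 0 ≤ Kur.P j k) (hP1 : ∀ j k, Kur.P j k ≤ 1)
    (hPs : ∀ j k, Kur.P j k = Kur.P k j) {c : ℝ} (hω : ∀ i, Kur.ω i = Kur.D i * c)
    (hφ : ∀ i j, Kur.φ i j = 0)
    (hdense : ∀ j, 4 * ∑ k ∈ Finset.univ.erase j, (1 - Kur.P j k) < (n : ℝ))
    {θu : Fin n → ℝ} (hθu : ∀ i, Kur.field θu i = (∑ j, Kur.ω j) / ∑ j, Kur.D j) :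
    (∀ ε > 0, ∃ δ > 0, ∀ x₁ : Fin n → ℝ, ‖x₁ - θu‖ < δ → ∀ θ : ℝ → Fin n → ℝ,
      θ 0 = x₁ → (∀ T : ℝ, ∀ t ∈ Icc 0 T, HasDerivWithinAt θ (Kur.field (θ t)) (Icc 0 T) t) →
      ∀ t, 0 ≤ t → ‖θ t - fun i => θu i + (∑ j, Kur.ω j) / (∑ j, Kur.D j) * t‖ < ε)
    ↔ ∀ i j, Real.cos (θu i - θu j) = 1 := by
  constructor
  · intro hst i j
    exact Kur.dense_cos_eq_one_of_stabilityMatrix_negSemidef hD hP0 hP1 hPs hω hφ hdense hθu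
      (Kur.stabilityMatrix_negSemidef_of_lockedSolution_stable hD hφ hPs hθu hst) i j
  · intro hin
    rcases Nat.eq_zero_or_pos n with hn | hn
    · -- no oscillators: every statement about `Fin 0 → ℝ` is about the zero vector
      subst hn
      intro ε hε
      refine ⟨1, one_pos, fun x₁ _ θ _ _ t _ => ?_⟩
      have : (θ t - fun i => θu i + (∑ j, Kur.ω j) / (∑ j, Kur.D j) * t) = 0 :=
        funext fun i => i.elim0
      rw [this, norm_zero]; exact hε
    · have hne : (Finset.univ : Finset (Fin n)).Nonempty := ⟨⟨0, hn⟩, Finset.mem_univ _⟩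
      set d : ℝ := Finset.univ.sup' hne (fun l => ∑ m ∈ Finset.univ.erase l, (1 - Kur.P l m))
        with hd
      have hdense' : ∀ l, ∑ m ∈ Finset.univ.erase l, (1 - Kur.P l m) ≤ d := fun l =>
        Finset.le_sup' (fun l => ∑ m ∈ Finset.univ.erase l, (1 - Kur.P l m)) (Finset.mem_univ l)
      have h4d : 4 * d < (n : ℝ) := by
        obtain ⟨l, -, hl⟩ := Finset.exists_mem_eq_sup' hne
          (fun l => ∑ m ∈ Finset.univ.erase l, (1 - Kur.P l m))
        rw [hd, hl]
        exact hdense l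
      have hconn := Kur.couplingConnected_of_dense hP0 hP1 hPs hdense' (by linarith)
      have hexp := Kur.lockedSolution_locally_expStable_of_normalOperation hD hφ hPs
        (fun i j _ => hP0 i j) hconn hθu (fun i j _ _ => by rw [hin i j]; exact one_pos)
      exact Kur.lockedSolution_stable_of_locally_expStable hD hexp

end NonuniformKuramoto

/-! ### §8. The swing twin: the damped second-order model on a dense network -/

namespace ClassicalModel

namespace LosslessSystem

variable {n : ℕ} (S : LosslessSystem n 0)

/-- `Σᵢ vᵢ Σⱼ wᵢⱼ(vᵢ − vⱼ) = ½ΣᵢΣⱼ wᵢⱼ(vᵢ − vⱼ)²` for symmetric `w`. [folklore] -/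
private theorem sum_mul_sum_mul_sub_eq_half' (w : Fin n → Fin n → ℝ)
    (hw : ∀ i j, w i j = w j i) (v : Fin n → ℝ) :
    ∑ i, v i * ∑ j, w i j * (v i - v j) = 1 / 2 * ∑ i, ∑ j, w i j * (v i - v j) ^ 2 := by
  have e1 : ∑ i, v i * ∑ j, w i j * (v i - v j) = ∑ i, ∑ j, w i j * (v i * (v i - v j)) := by
    refine Finset.sum_congr rfl fun i _ => ?_
    rw [Finset.mul_sum]
    exact Finset.sum_congr rfl fun j _ => by ring
  have e2 : ∑ i, ∑ j, w i j * (v i * (v i - v j)) = ∑ i, ∑ j, w i j * (v j * (v j - v i)) := by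
    rw [Finset.sum_comm]
    exact Finset.sum_congr rfl fun i _ => Finset.sum_congr rfl fun j _ => by rw [hw j i]
  have e3 : ∑ i, ∑ j, w i j * (v i * (v i - v j)) + ∑ i, ∑ j, w i j * (v j * (v j - v i))
      = ∑ i, ∑ j, w i j * (v i - v j) ^ 2 := by
    rw [← Finset.sum_add_distrib]
    refine Finset.sum_congr rfl fun i _ => ?_
    rw [← Finset.sum_add_distrib]
    exact Finset.sum_congr rfl fun j _ => by ring
  rw [e1]
  linarith

/-- ★★ **KST's Theorem 5 for the damped swing model**: unloaded (`P = 0`) lossless network-reduced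
swing model with symmetric couplings `0 ≤ Cᵢⱼ ≤ 1`, `Mᵢ, Dᵢ > 0`, every machine with coupling
deficit `4·Σ_{k≠j}(1 − Cⱼₖ) < n`: a synchronous state (`flow(θ) = 0`) whose rest point `(θ, 0)` is
Lyapunov stable (every motion from every `δ`-close state stays `ε`-close; motions exist,
`exists_globalSolution`) is the all-in-phase state — a stable rest point has a positive semidefinite
Hesse form (`hessForm_nonneg_of_stable`), which is the negative semidefinite stability matrix of the
first-order reading of the same data, and Theorem 5 applies («for both the Kuramoto system and the
power grid model»).
[cite: KassabovStrogatzTownsend2021, Theorem 5 (arXiv:2105.11406 p0008); ManikTimmeWitthaut2017, §3 Lemma 1 («for both the Kuramoto system and the power grid model»); Khalil2002, Theorem 4.7 (part 2)] -/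
theorem dense_cos_eq_one_of_stable (hC0 : ∀ j k, 0 ≤ S.C j k) (hC1 : ∀ j k, S.C j k ≤ 1)
    (hCs : ∀ j k, S.C j k = S.C k j) (hP : ∀ i, S.P i = 0) (hM : ∀ i, 0 < S.M i)
    (hD : ∀ i, 0 < S.D i)
    (hdense : ∀ j, 4 * ∑ k ∈ Finset.univ.erase j, (1 - S.C j k) < (n : ℝ))
    {θe : Fin n → ℝ} (hflow : ∀ i, S.flow θe i = 0)
    (hst : ∀ ε > 0, ∃ δ > 0, ∀ x₁ : (Fin n → ℝ) × (Fin n → ℝ), dist x₁ (θe, 0) < δ →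
      ∀ X : ℝ → (Fin n → ℝ) × (Fin n → ℝ), X 0 = x₁ →
        (∀ T : ℝ, ∀ t ∈ Icc 0 T, HasDerivWithinAt X (S.field (X t)) (Icc 0 T) t) →
        ∀ t, 0 ≤ t → dist (X t) (θe, 0) < ε)
    (i j : Fin n) : Real.cos (θe i - θe j) = 1 := by
  have he : S.IsEquilibrium θe := fun i => by rw [hP i, hflow i]
  -- the first-order reading of the same data
  set Kur : NonuniformKuramoto n := { D := S.D, ω := fun _ => 0, P := S.C, φ := fun _ _ => 0 }
    with hKur
  have hPK : ∀ j k, Kur.P j k = S.C j k := fun j k => rfl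
  -- a uniform deficit bound
  have hne : (Finset.univ : Finset (Fin n)).Nonempty := ⟨j, Finset.mem_univ j⟩
  set d : ℝ := Finset.univ.sup' hne (fun l => ∑ m ∈ Finset.univ.erase l, (1 - S.C l m)) with hd
  have hdense' : ∀ l, ∑ m ∈ Finset.univ.erase l, (1 - Kur.P l m) ≤ d :=
    fun l => Finset.le_sup' (fun l => ∑ m ∈ Finset.univ.erase l, (1 - S.C l m)) (Finset.mem_univ l)
  have hd0 : 0 ≤ d := le_trans (Finset.sum_nonneg fun m _ => by
    have := hC1 j m; simp only [hPK]; linarith) (hdense' j)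
  have h4d : 4 * d < (n : ℝ) := by
    obtain ⟨l, -, hl⟩ := Finset.exists_mem_eq_sup' hne (fun l => ∑ m ∈ Finset.univ.erase l, (1 - S.C l m))
    rw [hd, hl]
    exact hdense l
  -- the homogeneous fixed-point equations
  have hfix : ∀ l, ∑ m, Kur.P l m * Real.sin (θe l - θe m) = 0 := by
    intro l
    have h := hflow l
    simp only [flow, Finset.univ_eq_empty, Finset.sum_empty, add_zero] at h
    simpa only [hPK] using h
  -- a stable rest point has a PSD Hesse form = NSD stability matrix of the first-order reading
  have hpsd := S.hessForm_nonneg_of_stable hCs hM hD he hst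
  have hstK : ∀ z : Fin n → ℝ, z ⬝ᵥ ((-Kur.toDroopNetwork.lap θe) *ᵥ z) ≤ 0 := by
    intro z
    rw [Matrix.neg_mulVec, dotProduct_neg, neg_nonpos, Kur.dotProduct_lap_mulVec]
    have hw : ∀ a b, Kur.toDroopNetwork.linWeight θe a b = Kur.toDroopNetwork.linWeight θe b a := by
      intro a b
      rw [Kur.toDroopNetwork_linWeight, Kur.toDroopNetwork_linWeight, hPK, hPK, hCs a b,
        ← Real.cos_neg, neg_sub]
    rw [sum_mul_sum_mul_sub_eq_half' _ hw z]
    have h := hpsd z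
    simp only [Finset.univ_eq_empty, Finset.sum_empty, Finset.sum_const_zero, add_zero] at h
    have e : ∑ a, ∑ b, Kur.toDroopNetwork.linWeight θe a b * (z a - z b) ^ 2
        = ∑ a, ∑ b, S.C a b * Real.cos (θe a - θe b) * (z a - z b) ^ 2 :=
      Finset.sum_congr rfl fun a _ => Finset.sum_congr rfl fun b _ => by
        rw [Kur.toDroopNetwork_linWeight, hPK]
    rw [e]
    exact h
  exact Kur.inPhase_of_dense (fun j k => hC0 j k) (fun j k => hC1 j k) (fun j k => hCs j k) hfix
    hstK hd0 hdense' h4d i j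

/-- ★★★ **THE SWING DICHOTOMY ON A DENSE NETWORK**: under the same hypotheses a synchronous state is
a LYAPUNOV-STABLE rest point (for every `ε > 0` some `δ > 0`: every `δ`-close state has a motion
and all its motions stay `ε`-close) ⇔ it is the all-in-phase state ((⇐) MTW Cor. 1 for the motions,
`stable_syncSolution_of_normalOperation`; density ⇒ connectivity).
[cite: KassabovStrogatzTownsend2021, Theorem 5 (arXiv:2105.11406 p0008); ManikTimmeWitthaut2017, §3 Lemma 1 and Cor. 1; Khalil2002, Theorem 4.7] -/
theorem dense_stable_iff_inPhase (hC0 : ∀ j k, 0 ≤ S.C j k) (hC1 : ∀ j k, S.C j k ≤ 1)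
    (hCs : ∀ j k, S.C j k = S.C k j) (hP : ∀ i, S.P i = 0) (hM : ∀ i, 0 < S.M i)
    (hD : ∀ i, 0 < S.D i)
    (hdense : ∀ j, 4 * ∑ k ∈ Finset.univ.erase j, (1 - S.C j k) < (n : ℝ))
    {θe : Fin n → ℝ} (hflow : ∀ i, S.flow θe i = 0) :
    (∀ ε > 0, ∃ δ > 0, ∀ x₁ : (Fin n → ℝ) × (Fin n → ℝ), dist x₁ (θe, 0) < δ →
      (∃ X : ℝ → (Fin n → ℝ) × (Fin n → ℝ), X 0 = x₁ ∧
          ∀ T : ℝ, ∀ t ∈ Icc 0 T, HasDerivWithinAt X (S.field (X t)) (Icc 0 T) t) ∧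
        ∀ X : ℝ → (Fin n → ℝ) × (Fin n → ℝ), X 0 = x₁ →
          (∀ T : ℝ, ∀ t ∈ Icc 0 T, HasDerivWithinAt X (S.field (X t)) (Icc 0 T) t) →
          ∀ t, 0 ≤ t → dist (X t) (θe, 0) < ε)
    ↔ ∀ i j, Real.cos (θe i - θe j) = 1 := by
  constructor
  · intro hst i j
    refine S.dense_cos_eq_one_of_stable hC0 hC1 hCs hP hM hD hdense hflow (fun ε hε => ?_) i j
    obtain ⟨δ, hδ, h⟩ := hst ε hε
    exact ⟨δ, hδ, fun x₁ hx₁ X hX0 hX => (h x₁ hx₁).2 X hX0 hX⟩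
  · intro hin ε hε
    -- connectivity from density, through the first-order reading of the couplings
    set Kur : NonuniformKuramoto n := { D := S.D, ω := fun _ => 0, P := S.C, φ := fun _ _ => 0 }
      with hKur
    rcases Nat.eq_zero_or_pos n with hn | hn
    · subst hn
      refine ⟨1, one_pos, fun x₁ _ => ⟨?_, fun X hX0 _ t _ => ?_⟩⟩
      · obtain ⟨X, hX0, hX⟩ := S.exists_globalSolution x₁
        exact ⟨X, hX0, hX⟩
      · have e1 : X t = (θe, 0) := by
          ext i <;> exact i.elim0
        rw [e1, dist_self]; exact hε
    · have hne : (Finset.univ : Finset (Fin n)).Nonempty := ⟨⟨0, hn⟩, Finset.mem_univ _⟩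
      set d : ℝ := Finset.univ.sup' hne (fun l => ∑ m ∈ Finset.univ.erase l, (1 - S.C l m)) with hd
      have hdense' : ∀ l, ∑ m ∈ Finset.univ.erase l, (1 - Kur.P l m) ≤ d :=
        fun l => Finset.le_sup' (fun l => ∑ m ∈ Finset.univ.erase l, (1 - S.C l m)) (Finset.mem_univ l)
      have h4d : 4 * d < (n : ℝ) := by
        obtain ⟨l, -, hl⟩ := Finset.exists_mem_eq_sup' hne
          (fun l => ∑ m ∈ Finset.univ.erase l, (1 - S.C l m))
        rw [hd, hl]
        exact hdense l
      have hconn : CouplingConnected S.C :=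
        Kur.couplingConnected_of_dense (fun j k => hC0 j k) (fun j k => hC1 j k) (fun j k => hCs j k)
          hdense' (by linarith)
      have hPsum : (∑ j, S.P j) / (∑ j, S.D j) = 0 := by simp [hP]
      have hsync : ∀ i, S.P i - S.D i * ((∑ j, S.P j) / ∑ j, S.D j) = S.flow θe i := by
        intro i
        rw [hPsum, hP i, hflow i]
        ring
      have h := S.stable_syncSolution_of_normalOperation hCs (fun i j _ => hC0 i j) hconn hM hD hsync
        (fun i j _ _ => by rw [hin i j]; exact one_pos) hε
      simp only [hPsum, zero_mul, sub_zero, Prod.mk.eta] at h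
      obtain ⟨δ, hδ, hst⟩ := h
      refine ⟨δ, hδ, fun x₁ hx₁ => ?_⟩
      have hx₁' : dist x₁ (θe, fun _ : Fin n => (0 : ℝ)) < δ := hx₁
      obtain ⟨hex, hall⟩ := hst x₁ hx₁'
      exact ⟨hex, fun X hX0 hX t ht => ((hall X hX0 hX).1 t ht)⟩

end LosslessSystem

end ClassicalModel

end Literature.MathematicalPhysics.PowerSystems

end
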